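import Literature.MathematicalPhysics.QuantumLattice.HubbardSzSectorLadder
import Literature.MathematicalPhysics.QuantumLattice.HubbardWave0RepulsiveProofs
import Literature.MathematicalPhysics.QuantumLattice.PlaquettePairCouplings
import Summits.HubbardSuperconductivity.HubbardSuperconductivity.Theorems.ColourTheSpinSgEndpointSpinDescent

/-!
# Route `CooperPairDMottWalk`, crux `CooperPairDMott` (stmt-HubbardSuperconductivity-1177):
# the plaquette grand-canonical window from sector-wise spectral bounds

Support file for the stub `stub_pairTrialCeiling`. The pair ceiling (`pairTrialCeiling_of_plaquetteGCWindow`)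
consumes ONE plaquette datum: `μ, γ > 0` with `Re⟨v, (h − μN) v⟩ ≥ (e₄ − 4μ + γ)‖v‖²` for all `v`
orthogonal to the `(4, 0)` ground space of `h = hubbardTorus 2 2 1 U`. This file reduces that
grand-canonical statement to SECTOR-WISE bounds of the kind a certified exact diagonalisation produces
(`plaquetteGCWindow_of_sectorBounds`): (i) on every sector `(N↑, N↓) = (a, b) ≠ (2, 2)` the form of `h` is
`≥ e₄ + γ + μ(a + b − 4)`; (ii) inside the sector `(2, 2)`, orthogonally to the ground space, the form of
`h` is `≥ e₄ + γ` (a spectral gap `γ` above `e₄` in the sector; no simplicity of the ground state is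
needed). The reduction is the block-diagonal decomposition of a sector-preserving form over Lieb's sectors
(`re_form_eq_sum_sectorProj`, `gcForm_ge_of_sectorBounds`), valid on any finite site set.

References: E. H. Lieb, PRL 62 (1989) 1201 (sectors); H. Tasaki (2020) §2.2. All statements are
[folklore]; no definition is introduced.
-/

set_option linter.dupNamespace false

noncomputable section

namespace Summit.HubbardSuperconductivity.HubbardSuperconductivity.Theorems.CooperPairDMottWalk

open Matrix Finset Literature.MathematicalPhysics.QuantumLattice
open scoped ComplexOrder

section Sectors

variable {Λ : Type*} [LinearOrder Λ] [Fintype Λ]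

/-- **Every vector is the sum of its sector components** over `(a, b) ∈ [0, |Λ|]²`. [folklore] -/
theorem sum_sectorProj_all_eq (ψ : Fock (Orb Λ)) :
    ∑ ab ∈ Finset.range (Fintype.card Λ + 1) ×ˢ Finset.range (Fintype.card Λ + 1), sectorProj ab.1 ab.2 ψ = ψ := by
  funext s
  rw [Finset.sum_apply, Finset.sum_eq_single ((upPart s).card, (downPart s).card)]
  · rw [sectorProj_apply, if_pos ⟨rfl, rfl⟩]
  · rintro ⟨a, b⟩ _ hne
    rw [sectorProj_apply, if_neg]
    rintro ⟨ha, hb⟩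
    exact hne (Prod.ext ha.symm hb.symm)
  · intro h
    exfalso
    apply h
    rw [Finset.mem_product, Finset.mem_range, Finset.mem_range]
    exact ⟨Nat.lt_succ_of_le (Finset.card_le_univ _), Nat.lt_succ_of_le (Finset.card_le_univ _)⟩

/-- **Block-diagonal decomposition of a sector-preserving form**:
`⟨v, M v⟩ = Σ_{(a,b)} ⟨P_{ab} v, M P_{ab} v⟩`. Lieb, PRL 62 (1989) 1201. [folklore] -/
theorem form_eq_sum_sectorProj {M : Matrix (Finset (Orb Λ)) (Finset (Orb Λ)) ℂ} (hM : PreservesSectors M)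
    (v : Fock (Orb Λ)) :
    star v ⬝ᵥ (M *ᵥ v) =
      ∑ ab ∈ Finset.range (Fintype.card Λ + 1) ×ˢ Finset.range (Fintype.card Λ + 1),
        star (sectorProj ab.1 ab.2 v) ⬝ᵥ (M *ᵥ sectorProj ab.1 ab.2 v) := by
  set R := Finset.range (Fintype.card Λ + 1) ×ˢ Finset.range (Fintype.card Λ + 1) with hR
  conv_lhs => rw [← sum_sectorProj_all_eq v]
  rw [mulVec_sum, star_sum, sum_dotProduct]
  refine Finset.sum_congr rfl fun ab hab => ?_
  rw [dotProduct_sum, Finset.sum_eq_single ab]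
  · rintro cd - hne
    refine dotProduct_eq_zero_of_isInSector (a := ab.1) (b := ab.2) (a' := cd.1) (b' := cd.2) ?_
      (isInSector_sectorProj _ _ v) (hM.isInSector_mulVec (isInSector_sectorProj _ _ v))
    rintro ⟨h1, h2⟩
    exact hne (Prod.ext h1 h2).symm
  · intro h
    exact absurd hab h

/-- `‖v‖² = Σ_{(a,b)} ‖P_{ab} v‖²`. [folklore] -/
theorem normSq_eq_sum_sectorProj (v : Fock (Orb Λ)) :
    star v ⬝ᵥ v =
      ∑ ab ∈ Finset.range (Fintype.card Λ + 1) ×ˢ Finset.range (Fintype.card Λ + 1),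
        star (sectorProj ab.1 ab.2 v) ⬝ᵥ sectorProj ab.1 ab.2 v := by
  have h := form_eq_sum_sectorProj (PreservesSectors.diagonal fun _ : Finset (Orb Λ) => (1 : ℂ)) v
  simp only [diagonal_one, one_mulVec] at h
  exact h

/-- `N` acts as `a + b` on the sector `(a, b)`. [folklore] -/
theorem totalNumber_mulVec_of_isInSector {a b : ℕ} {ψ : Fock (Orb Λ)} (hψ : IsInSector a b ψ) :
    totalNumber *ᵥ ψ = ((a + b : ℕ) : ℂ) • ψ :=
  (LiebTwo.isNParticle_iff_totalNumber _ ψ).1 hψ.isNParticle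

/-- **The grand-canonical form from sector bounds.** Let `h` conserve `(N↑, N↓)`, let `W` be a set of
vectors of the distinguished sector `(a₀, b₀)`, and let `E, γ, μ` be reals. If `Re⟨v, h v⟩ ≥
(E + γ + μ((a + b) − (a₀ + b₀)))‖v‖²` on every other sector `(a, b)` and `Re⟨v, h v⟩ ≥ (E + γ)‖v‖²` on the
vectors of the sector `(a₀, b₀)` orthogonal to `W`, then `Re⟨v, (h − μN) v⟩ ≥ (E − μ(a₀ + b₀) + γ)‖v‖²`
for every `v` orthogonal to `W`. [folklore] -/
theorem gcForm_ge_of_sectorBounds {h : Matrix (Finset (Orb Λ)) (Finset (Orb Λ)) ℂ} (hPS : PreservesSectors h)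
    (a₀ b₀ : ℕ) (W : Set (Fock (Orb Λ))) (hW : ∀ w ∈ W, IsInSector a₀ b₀ w) (E γ μ : ℝ)
    (hoff : ∀ a b : ℕ, (a, b) ≠ (a₀, b₀) → ∀ v : Fock (Orb Λ), IsInSector a b v →
      (E + γ + μ * (((a + b : ℕ) : ℝ) - ((a₀ + b₀ : ℕ) : ℝ))) * (star v ⬝ᵥ v).re ≤ (star v ⬝ᵥ (h *ᵥ v)).re)
    (hin : ∀ v : Fock (Orb Λ), IsInSector a₀ b₀ v → (∀ w ∈ W, star w ⬝ᵥ v = 0) →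
      (E + γ) * (star v ⬝ᵥ v).re ≤ (star v ⬝ᵥ (h *ᵥ v)).re)
    (v : Fock (Orb Λ)) (hv : ∀ w ∈ W, star w ⬝ᵥ v = 0) :
    (E - μ * ((a₀ + b₀ : ℕ) : ℝ) + γ) * (star v ⬝ᵥ v).re ≤
      (star v ⬝ᵥ ((h - (μ : ℂ) • totalNumber) *ᵥ v)).re := by
  have hPS' : PreservesSectors (h - (μ : ℂ) • totalNumber) := by
    have hN : PreservesSectors (totalNumber : Matrix (Finset (Orb Λ)) (Finset (Orb Λ)) ℂ) := by
      rw [LiebThm1.totalNumber_eq_diagonal]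
      exact PreservesSectors.diagonal _
    have heq : h - (μ : ℂ) • totalNumber = h + (-(μ : ℂ)) • totalNumber := by rw [neg_smul, sub_eq_add_neg]
    rw [heq]
    exact hPS.add (hN.smul _)
  set R := Finset.range (Fintype.card Λ + 1) ×ˢ Finset.range (Fintype.card Λ + 1) with hR
  rw [form_eq_sum_sectorProj hPS' v, normSq_eq_sum_sectorProj v, Complex.re_sum, Complex.re_sum, Finset.mul_sum]
  refine Finset.sum_le_sum fun ab _ => ?_
  set u := sectorProj ab.1 ab.2 v with hu
  have huS : IsInSector ab.1 ab.2 u := isInSector_sectorProj _ _ v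
  have hN : totalNumber *ᵥ u = ((ab.1 + ab.2 : ℕ) : ℂ) • u := totalNumber_mulVec_of_isInSector huS
  have hform : (star u ⬝ᵥ ((h - (μ : ℂ) • totalNumber) *ᵥ u)).re =
      (star u ⬝ᵥ (h *ᵥ u)).re - μ * ((ab.1 + ab.2 : ℕ) : ℝ) * (star u ⬝ᵥ u).re := by
    rw [sub_mulVec, smul_mulVec, hN, smul_smul, dotProduct_sub, dotProduct_smul, smul_eq_mul, Complex.sub_re,
      ThermodynamicLimit.star_dotProduct_self_eq_re u]
    simp only [Complex.mul_re, Complex.ofReal_re, Complex.ofReal_im, Complex.natCast_re, Complex.natCast_im,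
      mul_zero, sub_zero]
  rw [hform]
  have hnn : 0 ≤ (star u ⬝ᵥ u).re := (Complex.nonneg_iff.1 (dotProduct_star_self_nonneg u)).1
  by_cases hab : (ab.1, ab.2) = (a₀, b₀)
  · -- the distinguished sector: `u ⊥ W`
    obtain ⟨rfl, rfl⟩ := Prod.mk.inj hab
    have hperp : ∀ w ∈ W, star w ⬝ᵥ u = 0 := by
      intro w hw
      rw [hu, Summit.HubbardSuperconductivity.ColourTheSpin.SgEndpoint.star_dotProduct_sectorProj, sectorProj_eq_self (hW w hw), hv w hw]
    have := hin u huS hperp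
    nlinarith
  · have := hoff ab.1 ab.2 hab u huS
    nlinarith

end Sectors

/-! ### The plaquette -/

/-- **The plaquette grand-canonical window from sector bounds.** For `h = hubbardTorus 2 2 1 U`,
`e₄ = minEnergyOn h (szSector 4 0)`: if `Re⟨v, h v⟩ ≥ (e₄ + γ + μ(a + b − 4))‖v‖²` on every sector
`(a, b) ≠ (2, 2)` and `Re⟨v, h v⟩ ≥ (e₄ + γ)‖v‖²` on the `(2, 2)` vectors orthogonal to the `(4, 0)` ground
space, then `Re⟨v, (h − μN) v⟩ ≥ (e₄ − 4μ + γ)‖v‖²` for all `v` orthogonal to the `(4, 0)` ground space — the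
hypothesis of `pairTrialCeiling_of_plaquetteGCWindow`. [folklore] -/
theorem plaquetteGCWindow_of_sectorBounds (U μ γ : ℝ)
    (hoff : ∀ a b : ℕ, (a, b) ≠ (2, 2) → ∀ v : Fock (Orb (FermionTorus 2 2)), IsInSector a b v →
      ((hubbardTorus 2 2 1 U).minEnergyOn (szSector 4 0) + γ + μ * (((a + b : ℕ) : ℝ) - 4)) * (star v ⬝ᵥ v).re ≤
        (star v ⬝ᵥ (hubbardTorus 2 2 1 U *ᵥ v)).re)
    (hin : ∀ v : Fock (Orb (FermionTorus 2 2)), IsInSector 2 2 v →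
      (∀ w ∈ szSector (Λ := FermionTorus 2 2) 4 0,
        hubbardTorus 2 2 1 U *ᵥ w = (((hubbardTorus 2 2 1 U).minEnergyOn (szSector 4 0) : ℝ) : ℂ) • w →
          star w ⬝ᵥ v = 0) →
      ((hubbardTorus 2 2 1 U).minEnergyOn (szSector 4 0) + γ) * (star v ⬝ᵥ v).re ≤
        (star v ⬝ᵥ (hubbardTorus 2 2 1 U *ᵥ v)).re) :
    ∀ v : Fock (Orb (FermionTorus 2 2)),
      (∀ w ∈ szSector (Λ := FermionTorus 2 2) 4 0,
        hubbardTorus 2 2 1 U *ᵥ w = (((hubbardTorus 2 2 1 U).minEnergyOn (szSector 4 0) : ℝ) : ℂ) • w →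
          star w ⬝ᵥ v = 0) →
      ((hubbardTorus 2 2 1 U).minEnergyOn (szSector 4 0) - 4 * μ + γ) * (star v ⬝ᵥ v).re ≤
        (star v ⬝ᵥ ((hubbardTorus 2 2 1 U - (μ : ℂ) • totalNumber) *ᵥ v)).re := by
  intro v hv
  set W : Set (Fock (Orb (FermionTorus 2 2))) := {w | w ∈ szSector (Λ := FermionTorus 2 2) 4 0 ∧
    hubbardTorus 2 2 1 U *ᵥ w = (((hubbardTorus 2 2 1 U).minEnergyOn (szSector 4 0) : ℝ) : ℂ) • w} with hWdef
  have hW : ∀ w ∈ W, IsInSector 2 2 w := fun w hw => (mem_szSector_two_mul_zero_iff 2 w).1 hw.1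
  have hPS : PreservesSectors (hubbardTorus 2 2 1 U) := LiebThm1.preservesSectors_hamiltonian plaquetteGraph 1 U
  have h := gcForm_ge_of_sectorBounds hPS 2 2 W hW
    ((hubbardTorus 2 2 1 U).minEnergyOn (szSector 4 0)) γ μ
    (fun a b hab w hw => by have := hoff a b hab w hw; push_cast at this ⊢; linarith)
    (fun w hwS hperp => hin w hwS fun w' hw'S hw'E => hperp w' ⟨hw'S, hw'E⟩) v
    (fun w hw => hv w hw.1 hw.2)
  push_cast at h
  linarith

/-! ### Registered form -/

/-- **Registered sub-goal `pairTrialCeiling_windowReduction`** (closed form, as registered on the crux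
item): the plaquette grand-canonical window follows from sector-wise spectral bounds. [folklore] -/
theorem pairTrialCeiling_windowReduction : ∀ (U μ γ : ℝ), (∀ a b : ℕ, (a, b) ≠ (2, 2) → ∀ v : Fock (Orb (FermionTorus 2 2)), IsInSector a b v → ((hubbardTorus 2 2 1 U).minEnergyOn (szSector 4 0) + γ + μ * (((a + b : ℕ) : ℝ) - 4)) * (star v ⬝ᵥ v).re ≤ (star v ⬝ᵥ (hubbardTorus 2 2 1 U *ᵥ v)).re) → (∀ v : Fock (Orb (FermionTorus 2 2)), IsInSector 2 2 v → (∀ w ∈ szSector (Λ := FermionTorus 2 2) 4 0, hubbardTorus 2 2 1 U *ᵥ w = (((hubbardTorus 2 2 1 U).minEnergyOn (szSector 4 0) : ℝ) : ℂ) • w → star w ⬝ᵥ v = 0) → ((hubbardTorus 2 2 1 U).minEnergyOn (szSector 4 0) + γ) * (star v ⬝ᵥ v).re ≤ (star v ⬝ᵥ (hubbardTorus 2 2 1 U *ᵥ v)).re) → ∀ v : Fock (Orb (FermionTorus 2 2)), (∀ w ∈ szSector (Λ := FermionTorus 2 2) 4 0, hubbardTorus 2 2 1 U *ᵥ w = (((hubbardTorus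 2 2 1 U).minEnergyOn (szSector 4 0) : ℝ) : ℂ) • w → star w ⬝ᵥ v = 0) → ((hubbardTorus 2 2 1 U).minEnergyOn (szSector 4 0) - 4 * μ + γ) * (star v ⬝ᵥ v).re ≤ (star v ⬝ᵥ ((hubbardTorus 2 2 1 U - (μ : ℂ) • totalNumber) *ᵥ v)).re :=
  fun U μ γ hoff hin => plaquetteGCWindow_of_sectorBounds U μ γ hoff hin

end Summit.HubbardSuperconductivity.HubbardSuperconductivity.Theorems.CooperPairDMottWalk

end
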